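import Literature.AlgebraicGeometry.Kloosterman2025.ExceptionalSetConeDescent
import HarnessLib

/-!
# Kloosterman 2025, Theorem 4.9 / Proposition 4.7: the exceptional set GROWS with the degree, and the cone count
without emptiness hypotheses

R. Kloosterman, *On a conjecture on Hodge loci of linear combinations of linear subvarieties*, Rend. Circ. Mat.
Palermo (2) 74 (2025) = arXiv:2312.12363 [cite: Kloosterman2025], proof of Theorem 4.9: "the induction step is
Proposition 4.7 … In particular the number of `λ`, where the rank drops, does not increase"; and R. Kloosterman,
*Hodge loci associated with linear subspaces intersecting in codimension one*, Math. Nachr. 298 (2025) =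
arXiv:2401.10775 [cite: Kloosterman2025CodimOne], proof of Proposition 4.2 ("The induction step is [RNKMov, Prop. 4.7]
combined with [RNKMov, Thm. 4.9]") and of Theorem 4.8 (`X_{k,d}` is the `(k−2)`-fold cone of `X_{2,d}`).

Proposition 4.7 computes the left kernel of the pencil of the cone `X̃` in degree `d` as the direct sum of the left
kernels of the pencil of `X` in the degrees `d − δ'`, `δ' ≥ 0` (tree: `excessSet_tensorFunctional_subset`,
`E_a(ℓ₁ ⊗ ℓ_C, ℓ₂ ⊗ ℓ_C) ⊆ ⋃_{a' ≤ a} E_{a'}(ℓ₁, ℓ₂)`), and the printed conclusion "the number of `λ`, where the rank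
drops, does not increase" tacitly uses that an exceptional `λ` in a LOWER degree is also exceptional in degree `d`. This
file proves that step — for functionals `ℓ₁, ℓ₂` concentrated in degree `t` the exceptional sets increase with the
degree up to `t` and are empty above `t`,

  `E_0 ⊆ E_1 ⊆ ⋯ ⊆ E_t`,  `E_a = ∅ (a > t)`  (`excessSet_mono`, `excessSet_eq_empty_of_lt`),

because a witness `w ∈ I(ℓ₁ + cℓ₂)_a ∖ (I₁ ∩ I₂)_a`, `a < t`, has a multiple `x_i w ∉ I₁ ∩ I₂` (the socle of `S/I_j`
sits in degree `t`, tree `mem_annIdeal_of_forall_X_mul_mem`) — and derives the hypothesis-free forms of the tree's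
join/cone statements:

* `excessSet_tensorFunctional_subset_of_le`: `E_a(ℓ₁ ⊗ ℓ_C, ℓ₂ ⊗ ℓ_C) ⊆ E_a(ℓ₁, ℓ₂)` for `a ≤ t` (the tree's
  `excessSet_tensorFunctional_subset_of_forall_lt` asked for `E_{a'}(ℓ₁,ℓ₂) = ∅`, `a' < a`);
* `exists_excessSet_cone_eq_tensor`: the bookkeeping of the tree's `excessSet_cone`, exposed — the exceptional set of
  the `m`-fold cone in Kloosterman's normal form has the same size as that of the join `ℓ⁰₁ ⊗ ℓ_C, ℓ⁰₂ ⊗ ℓ_C` of the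
  base cycle functionals with a socle functional `ℓ_C` of `⟨y_i^{d−1}, z_i⟩_i`;
* **`ncard_excessSet_cone_le`** (Theorem 4.9, "the number of `λ` where the rank drops does not increase", with no
  hypothesis on the lower degrees): for `a ≤ (k₀+1)(d−2)`, if `E_a` of the base is finite then `E_a` of the `m`-fold
  cone is finite with at most as many elements; `excessSet_cone_finite_iff_of_le`: and only then;
* (addendum) **persistence**, the other half of Proposition 4.7's equality: `excessSet_subset_excessSet_tensorFunctional`
  (`E_a(ℓ₁,ℓ₂) ⊆ E_a(ℓ₁ ⊗ ℓ_C, ℓ₂ ⊗ ℓ_C)` for every non-zero `ℓ_C` — a witness of the base is a witness of the join),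
  `ncard_excessSet_cone_ge`, and **`ncard_excessSet_cone_eq`**: for `a ≤ (k₀+1)(d−2)` and `E_a(base)` finite,
  `#E_a(cone) = #E_a(base)` — the number of exceptional `λ` does not change along the cone.

All statements are about the tree's `excessSet` [cite: Kloosterman2025, Theorem 3.13, Lemma 3.12]; no new definitions,
no named facts.
-/

noncomputable section

open MvPolynomial Module Literature.RingTheory.MvPolynomial

namespace Literature.AlgebraicGeometry.Kloosterman2025

/-! ## Section 1 — monotonicity of the exceptional set in the degree -/

section Monotone

variable {K : Type*} [Field K] {σ : Type*} {t : ℕ} {ℓ₁ ℓ₂ : MvPolynomial σ K →ₗ[K] K}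

/-- A form of degree `a < t` outside `I(ℓ)` has a multiple `x_i·f` outside `I(ℓ)` (the socle of `S/I(ℓ)` is `(S/I(ℓ))_t`;
"since `α < t` we can find a linear form `l` such that `l f` is nonzero"). [cite: Kloosterman2025, Lemma 2.10 (proof)] -/
theorem exists_X_mul_notMem_annIdeal {ℓ : MvPolynomial σ K →ₗ[K] K}
    (hℓ : ∀ p, ℓ (homogeneousComponent t p) = ℓ p) {f : MvPolynomial σ K} {a : ℕ} (hf : f.IsHomogeneous a)
    (ha : a < t) (hfI : f ∉ annIdeal ℓ) : ∃ i : σ, X i * f ∉ annIdeal ℓ := by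
  by_contra H
  push Not at H
  exact hfI (mem_annIdeal_of_forall_X_mul_mem hℓ hf ha H)

/-- **The exceptional set grows with the degree below the socle degree**: for `ℓ₁, ℓ₂` concentrated in degree `t` and
`a < t`, `E_a(ℓ₁,ℓ₂) ⊆ E_{a+1}(ℓ₁,ℓ₂)` — a witness `w ∈ I(ℓ₁ + cℓ₂)_a` not in `I₁ ∩ I₂` has a multiple `x_i w` of degree
`a + 1` with the same property (the step used tacitly in "the number of `λ`, where the rank drops, does not increase").
[cite: Kloosterman2025, Theorem 4.9 (proof), Proposition 4.7] -/
theorem excessSet_subset_succ (hℓ₁ : ∀ p, ℓ₁ (homogeneousComponent t p) = ℓ₁ p)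
    (hℓ₂ : ∀ p, ℓ₂ (homogeneousComponent t p) = ℓ₂ p) {a : ℕ} (ha : a < t) :
    excessSet ℓ₁ ℓ₂ a ⊆ excessSet ℓ₁ ℓ₂ (a + 1) := by
  intro c hc
  obtain ⟨hc0, w, hwa, hwin, hwout⟩ := mem_excessSet_iff_exists.mp hc
  rw [mem_excessSet_iff_exists]
  refine ⟨hc0, ?_⟩
  have key : ∀ {ℓ : MvPolynomial σ K →ₗ[K] K}, (∀ p, ℓ (homogeneousComponent t p) = ℓ p) → w ∉ annIdeal ℓ →
      ∃ w' : MvPolynomial σ K, w'.IsHomogeneous (a + 1) ∧ w' ∈ annIdeal (ℓ₁ + c • ℓ₂) ∧ w' ∉ annIdeal ℓ := by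
    intro ℓ hℓ hw
    obtain ⟨i, hi⟩ := exists_X_mul_notMem_annIdeal hℓ hwa ha hw
    refine ⟨X i * w, ?_, Ideal.mul_mem_left _ _ hwin, hi⟩
    have h := (isHomogeneous_X K i).mul hwa
    rwa [Nat.add_comm] at h
  by_cases h1 : w ∈ annIdeal ℓ₁
  · have h2 : w ∉ annIdeal ℓ₂ := fun h2 => hwout ⟨h1, h2⟩
    obtain ⟨w', hw'a, hw'in, hw'out⟩ := key hℓ₂ h2
    exact ⟨w', hw'a, hw'in, fun h => hw'out h.2⟩
  · obtain ⟨w', hw'a, hw'in, hw'out⟩ := key hℓ₁ h1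
    exact ⟨w', hw'a, hw'in, fun h => hw'out h.1⟩

/-- `E_a ⊆ E_b` for `a ≤ b ≤ t`. [cite: Kloosterman2025, Theorem 4.9 (proof), Proposition 4.7] -/
theorem excessSet_mono (hℓ₁ : ∀ p, ℓ₁ (homogeneousComponent t p) = ℓ₁ p)
    (hℓ₂ : ∀ p, ℓ₂ (homogeneousComponent t p) = ℓ₂ p) {a b : ℕ} (hab : a ≤ b) (hbt : b ≤ t) :
    excessSet ℓ₁ ℓ₂ a ⊆ excessSet ℓ₁ ℓ₂ b := by
  induction b, hab using Nat.le_induction with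
  | base => exact subset_rfl
  | succ b hab ih => exact (ih (by omega)).trans (excessSet_subset_succ hℓ₁ hℓ₂ (by omega))

/-- **Above the socle degree there is no excess**: `E_a(ℓ₁,ℓ₂) = ∅` for `a > t` (every form of degree `> t` lies in
`I₁ ∩ I₂`). [cite: Kloosterman2025, Lemma 2.1, Theorem 3.13] -/
theorem excessSet_eq_empty_of_lt (hℓ₁ : ∀ p, ℓ₁ (homogeneousComponent t p) = ℓ₁ p)
    (hℓ₂ : ∀ p, ℓ₂ (homogeneousComponent t p) = ℓ₂ p) {a : ℕ} (hta : t < a) : excessSet ℓ₁ ℓ₂ a = ∅ := by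
  ext c
  simp only [Set.mem_empty_iff_false, iff_false]
  intro hc
  obtain ⟨-, w, hwa, -, hwout⟩ := mem_excessSet_iff_exists.mp hc
  exact hwout ⟨mem_annIdeal_of_isHomogeneous_of_lt hℓ₁ hwa hta, mem_annIdeal_of_isHomogeneous_of_lt hℓ₂ hwa hta⟩

/-- Hence `⋃_{a' ≤ a} E_{a'} = E_a` for `a ≤ t`. [cite: Kloosterman2025, Theorem 4.9 (proof), Proposition 4.7] -/
theorem biUnion_excessSet_eq (hℓ₁ : ∀ p, ℓ₁ (homogeneousComponent t p) = ℓ₁ p)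
    (hℓ₂ : ∀ p, ℓ₂ (homogeneousComponent t p) = ℓ₂ p) {a : ℕ} (hat : a ≤ t) :
    (⋃ a' ≤ a, excessSet ℓ₁ ℓ₂ a') = excessSet ℓ₁ ℓ₂ a := by
  apply subset_antisymm
  · exact Set.iUnion₂_subset fun a' ha' => excessSet_mono hℓ₁ hℓ₂ ha' hat
  · exact Set.subset_iUnion₂ (s := fun a' (_ : a' ≤ a) => excessSet ℓ₁ ℓ₂ a') a le_rfl

/-- … and in general `⋃_{a' ≤ a} E_{a'} ⊆ E_{min(a,t)}`. [cite: Kloosterman2025, Theorem 4.9 (proof), Proposition 4.7] -/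
theorem biUnion_excessSet_subset_min (hℓ₁ : ∀ p, ℓ₁ (homogeneousComponent t p) = ℓ₁ p)
    (hℓ₂ : ∀ p, ℓ₂ (homogeneousComponent t p) = ℓ₂ p) (a : ℕ) :
    (⋃ a' ≤ a, excessSet ℓ₁ ℓ₂ a') ⊆ excessSet ℓ₁ ℓ₂ (min a t) := by
  refine Set.iUnion₂_subset fun a' ha' => ?_
  by_cases h : a' ≤ t
  · exact excessSet_mono hℓ₁ hℓ₂ (le_min ha' h) (min_le_right a t)
  · rw [excessSet_eq_empty_of_lt hℓ₁ hℓ₂ (not_le.mp h)]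
    exact Set.empty_subset _

/-- **All the exceptional sets are controlled by the one in the socle degree**: `E_a ⊆ E_{min(a,t)} ⊆ E_t`; in
particular if `E_t` is finite, every `E_a` is. [cite: Kloosterman2025, Theorem 3.13] -/
theorem excessSet_subset_top (hℓ₁ : ∀ p, ℓ₁ (homogeneousComponent t p) = ℓ₁ p)
    (hℓ₂ : ∀ p, ℓ₂ (homogeneousComponent t p) = ℓ₂ p) (a : ℕ) : excessSet ℓ₁ ℓ₂ a ⊆ excessSet ℓ₁ ℓ₂ t :=
  ((Set.subset_iUnion₂ (s := fun a' (_ : a' ≤ a) => excessSet ℓ₁ ℓ₂ a') a le_rfl).trans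
    (biUnion_excessSet_subset_min hℓ₁ hℓ₂ a)).trans (excessSet_mono hℓ₁ hℓ₂ (min_le_right a t) le_rfl)

end Monotone

/-! ## Section 2 — joins: `E_a(ℓ₁ ⊗ ℓ_C, ℓ₂ ⊗ ℓ_C) ⊆ E_a(ℓ₁, ℓ₂)` with no hypothesis on lower degrees -/

section Join

open DuqueFrancoVillaflor2025

variable {K : Type*} [Field K] {σ τ : Type*} {t tC : ℕ} {ℓ₁ ℓ₂ : MvPolynomial σ K →ₗ[K] K}
  {ℓC : MvPolynomial τ K →ₗ[K] K}

/-- **Proposition 4.7 ⇒ "the number of `λ` where the rank drops does not increase"**, hypothesis-free: for `ℓ₁, ℓ₂`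
concentrated in degree `t`, `ℓ_C` in degree `t_C`, and `a ≤ t`, `E_a(ℓ₁ ⊗ ℓ_C, ℓ₂ ⊗ ℓ_C) ⊆ E_a(ℓ₁, ℓ₂)`.
[cite: Kloosterman2025, Proposition 4.7, Theorem 4.9 (proof)] -/
theorem excessSet_tensorFunctional_subset_of_le (hℓ₁ : ∀ p, ℓ₁ (homogeneousComponent t p) = ℓ₁ p)
    (hℓ₂ : ∀ p, ℓ₂ (homogeneousComponent t p) = ℓ₂ p) (hℓC : ∀ p, ℓC (homogeneousComponent tC p) = ℓC p)
    {a : ℕ} (hat : a ≤ t) :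
    excessSet (tensorFunctional ℓ₁ ℓC) (tensorFunctional ℓ₂ ℓC) a ⊆ excessSet ℓ₁ ℓ₂ a := by
  have h := excessSet_tensorFunctional_subset (ℓ₁ := ℓ₁) (ℓ₂ := ℓ₂) hℓC a
  rwa [biUnion_excessSet_eq hℓ₁ hℓ₂ hat] at h

/-- … and for every `a`: `E_a(ℓ₁ ⊗ ℓ_C, ℓ₂ ⊗ ℓ_C) ⊆ E_{min(a,t)}(ℓ₁, ℓ₂)`. [cite: Kloosterman2025, Proposition 4.7] -/
theorem excessSet_tensorFunctional_subset_min (hℓ₁ : ∀ p, ℓ₁ (homogeneousComponent t p) = ℓ₁ p)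
    (hℓ₂ : ∀ p, ℓ₂ (homogeneousComponent t p) = ℓ₂ p) (hℓC : ∀ p, ℓC (homogeneousComponent tC p) = ℓC p)
    (a : ℕ) : excessSet (tensorFunctional ℓ₁ ℓC) (tensorFunctional ℓ₂ ℓC) a ⊆ excessSet ℓ₁ ℓ₂ (min a t) :=
  (excessSet_tensorFunctional_subset (ℓ₁ := ℓ₁) (ℓ₂ := ℓ₂) hℓC a).trans (biUnion_excessSet_subset_min hℓ₁ hℓ₂ a)

/-- Sizes: for `a ≤ t`, if `E_a(ℓ₁,ℓ₂)` is finite then `E_a` of the join is finite with at most as many elements.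
[cite: Kloosterman2025, Proposition 4.7, Theorem 4.9 (proof)] -/
theorem ncard_excessSet_tensorFunctional_le (hℓ₁ : ∀ p, ℓ₁ (homogeneousComponent t p) = ℓ₁ p)
    (hℓ₂ : ∀ p, ℓ₂ (homogeneousComponent t p) = ℓ₂ p) (hℓC : ∀ p, ℓC (homogeneousComponent tC p) = ℓC p)
    {a : ℕ} (hat : a ≤ t) (hfin : (excessSet ℓ₁ ℓ₂ a).Finite) :
    (excessSet (tensorFunctional ℓ₁ ℓC) (tensorFunctional ℓ₂ ℓC) a).Finite ∧
      (excessSet (tensorFunctional ℓ₁ ℓC) (tensorFunctional ℓ₂ ℓC) a).ncard ≤ (excessSet ℓ₁ ℓ₂ a).ncard :=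
  ⟨hfin.subset (excessSet_tensorFunctional_subset_of_le hℓ₁ hℓ₂ hℓC hat),
    Set.ncard_le_ncard (excessSet_tensorFunctional_subset_of_le hℓ₁ hℓ₂ hℓC hat) hfin⟩

end Join

/-! ## Section 3 — the `m`-fold cone in Kloosterman's normal form: the count of Theorem 4.9 without hypotheses on the
lower degrees -/

section Cone

open DuqueFrancoVillaflor2025 HodgeTheory Motives.UniversalHypersurface

variable {K : Type*} [Field K] {k₀ c r₀ : ℕ}
  {m d : ℕ} {κ₀ : Fin c ⊕ Fin r₀ ≃ Fin (k₀ + 1)} {κ : Fin c ⊕ Fin (r₀ + m) ≃ Fin (k₀ + m + 1)}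
  {gA h : Fin c → MvPolynomial (Fin (2 * k₀ + 2)) K} {gC : Fin r₀ → MvPolynomial (Fin (2 * k₀ + 2)) K}
  {Q : Fin c → Fin c → MvPolynomial (Fin (2 * k₀ + 2)) K} {P : Fin r₀ → MvPolynomial (Fin (2 * k₀ + 2)) K}

/-- `q ∈ I.map (rename θ) ↔ rename θ⁻¹ q ∈ I` for a bijection `θ` of variable sets. [folklore] -/
private theorem mem_map_rename_iff (α β : Type*) (θ : α ≃ β) (I : Ideal (MvPolynomial α K)) (q : MvPolynomial β K) :
    q ∈ I.map (rename θ : MvPolynomial α K →ₐ[K] MvPolynomial β K) ↔ rename θ.symm q ∈ I := by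
  have e : I.map (rename θ : MvPolynomial α K →ₐ[K] MvPolynomial β K) =
      I.comap (rename θ.symm : MvPolynomial β K →ₐ[K] MvPolynomial α K) := by
    apply le_antisymm
    · refine Ideal.map_le_iff_le_comap.mpr fun g hg => ?_
      rw [Ideal.mem_comap, Ideal.mem_comap, rename_rename, Equiv.symm_comp_self, rename_id, AlgHom.id_apply]
      exact hg
    · intro q hq
      rw [Ideal.mem_comap] at hq
      have hq' : rename θ (rename θ.symm q) = q := by
        rw [rename_rename, Equiv.self_comp_symm, rename_id, AlgHom.id_apply]
      rw [← hq']
      exact Ideal.mem_map_of_mem _ hq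
  rw [e, Ideal.mem_comap]

/-- `(I.map (rename θ)).map (rename θ⁻¹) = I`. [folklore] -/
private theorem map_rename_map_rename_symm' (α β : Type*) (θ : α ≃ β) (I : Ideal (MvPolynomial α K)) :
    (I.map (rename θ : MvPolynomial α K →ₐ[K] MvPolynomial β K)).map
        (rename θ.symm : MvPolynomial β K →ₐ[K] MvPolynomial α K) = I := by
  ext q
  rw [mem_map_rename_iff, Equiv.symm_symm, mem_map_rename_iff, rename_rename, Equiv.symm_comp_self,
    rename_id, AlgHom.id_apply]

/-- Pulling a non-zero functional back along a relabelling keeps it non-zero. [folklore] -/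
private theorem comp_rename_ne_zero' (α β : Type*) (θ : α ≃ β) {ℓ : MvPolynomial β K →ₗ[K] K} (hℓ : ℓ ≠ 0) :
    ℓ ∘ₗ (rename θ : MvPolynomial α K →ₐ[K] MvPolynomial β K).toLinearMap ≠ 0 := by
  intro h0
  apply hℓ
  refine LinearMap.ext fun q => ?_
  have := LinearMap.congr_fun h0 (rename θ.symm q)
  simpa only [LinearMap.coe_comp, Function.comp_apply, AlgHom.toLinearMap_apply, rename_rename,
    Equiv.self_comp_symm, rename_id, AlgHom.id_apply, LinearMap.zero_apply] using this

/-- Pulling back along a relabelling preserves concentration in degree `t`. [folklore] -/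
private theorem comp_rename_homogeneousComponent' (α β : Type*) {t : ℕ} (θ : α ≃ β)
    {ℓ : MvPolynomial α K →ₗ[K] K} (hℓ : ∀ p, ℓ (homogeneousComponent t p) = ℓ p) (q : MvPolynomial β K) :
    (ℓ ∘ₗ (rename θ.symm : MvPolynomial β K →ₐ[K] MvPolynomial α K).toLinearMap) (homogeneousComponent t q) =
      (ℓ ∘ₗ (rename θ.symm : MvPolynomial β K →ₐ[K] MvPolynomial α K).toLinearMap) q := by
  simp only [LinearMap.coe_comp, Function.comp_apply, AlgHom.toLinearMap_apply]
  rw [rename_homogeneousComponent, hℓ]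

/-- The base cycle functional `ℓ⁰(·D₁)` is concentrated in degree `(k₀+1)(d−2)`. [cite: Kloosterman2025, Construction 3.1,
Example 3.5] -/
theorem ciCycleFunctional_plane₁_homogeneousComponent (hd : 2 ≤ d)
    (hgA : ∀ i, (gA i).IsHomogeneous 1) (hh : ∀ j, (h j).IsHomogeneous 1) (hgC : ∀ l, (gC l).IsHomogeneous 1)
    (hQ : ∀ i j, (Q i j).IsHomogeneous (d - 2)) (hP : ∀ l, (P l).IsHomogeneous (d - 1))
    {ℓ₀ : MvPolynomial (Fin (2 * k₀ + 2)) K →ₗ[K] K}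
    (hℓ₀ : ∀ p, ℓ₀ (homogeneousComponent ((2 * k₀ + 2) * (d - 2)) p) = ℓ₀ p) (p : MvPolynomial (Fin (2 * k₀ + 2)) K) :
    ciCycleFunctional ℓ₀ (plane₁Gens κ₀ gA gC) (plane₁Cofs κ₀ h Q P) (homogeneousComponent ((k₀ + 1) * (d - 2)) p) =
      ciCycleFunctional ℓ₀ (plane₁Gens κ₀ gA gC) (plane₁Cofs κ₀ h Q P) p :=
  ciCycleFunctional_homogeneousComponent (plane₁Gens κ₀ gA gC) (plane₁Cofs κ₀ h Q P) (fun _ => 1) (fun _ => d - 1)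
    (isHomogeneous_plane₁Gens κ₀ hgA hgC) (isHomogeneous_plane₁Cofs κ₀ hd hh hQ hP) (fun _ => Nat.one_pos)
    (fun _ => by omega) (fun _ => by omega) hℓ₀ p

/-- The base cycle functional `ℓ⁰(·D₂)` is concentrated in degree `(k₀+1)(d−2)`. [cite: Kloosterman2025, Construction 3.1,
Example 3.5] -/
theorem ciCycleFunctional_plane₂_homogeneousComponent (hd : 2 ≤ d)
    (hgA : ∀ i, (gA i).IsHomogeneous 1) (hh : ∀ j, (h j).IsHomogeneous 1) (hgC : ∀ l, (gC l).IsHomogeneous 1)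
    (hQ : ∀ i j, (Q i j).IsHomogeneous (d - 2)) (hP : ∀ l, (P l).IsHomogeneous (d - 1))
    {ℓ₀ : MvPolynomial (Fin (2 * k₀ + 2)) K →ₗ[K] K}
    (hℓ₀ : ∀ p, ℓ₀ (homogeneousComponent ((2 * k₀ + 2) * (d - 2)) p) = ℓ₀ p) (p : MvPolynomial (Fin (2 * k₀ + 2)) K) :
    ciCycleFunctional ℓ₀ (plane₂Gens κ₀ h gC) (plane₂Cofs κ₀ gA Q P) (homogeneousComponent ((k₀ + 1) * (d - 2)) p) =
      ciCycleFunctional ℓ₀ (plane₂Gens κ₀ h gC) (plane₂Cofs κ₀ gA Q P) p :=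
  ciCycleFunctional_homogeneousComponent (plane₂Gens κ₀ h gC) (plane₂Cofs κ₀ gA Q P) (fun _ => 1) (fun _ => d - 1)
    (isHomogeneous_plane₂Gens κ₀ hh hgC) (isHomogeneous_plane₂Cofs κ₀ hd hgA hQ hP) (fun _ => Nat.one_pos)
    (fun _ => by omega) (fun _ => by omega) hℓ₀ p

/-- **The exceptional set of the cone is, in size, the exceptional set of a join** (the bookkeeping behind the tree's
`excessSet_cone`, exposed): with the notation of `excessSet_cone` there is a socle functional `ℓ_C` of the block ideal
`⟨y_i^{d−1}, z_i⟩_i` (concentrated in degree `m(d−2)`) such that, in every degree `a`, `E_a` of the cone's cycle functionals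
and `E_a(ℓ⁰₁ ⊗ ℓ_C, ℓ⁰₂ ⊗ ℓ_C)` have the same number of elements and are finite together ("`Ĩ_j = S̃ I(γ_j) +
⟨x_{2k+2}^{d−1}, x_{2k+3}⟩`"; the cone functionals are the relabelled joins up to non-zero scalars).
[cite: Kloosterman2025, Proposition 4.7 (proof), Theorem 4.9 (proof)] -/
theorem exists_excessSet_cone_eq_tensor [CharZero K] (hd : 3 ≤ d)
    (hgA : ∀ i, (gA i).IsHomogeneous 1) (hh : ∀ j, (h j).IsHomogeneous 1) (hgC : ∀ l, (gC l).IsHomogeneous 1)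
    (hQ : ∀ i j, (Q i j).IsHomogeneous (d - 2)) (hP : ∀ l, (P l).IsHomogeneous (d - 1))
    {N₀ : ℕ} (hN₀ : 0 < N₀)
    (hXN₀ : ∀ l, (X l : MvPolynomial (Fin (2 * k₀ + 2)) K) ^ N₀ ∈ jacobianIdeal (twoPlanesForm gA h gC Q P))
    {ℓ₀ : MvPolynomial (Fin (2 * k₀ + 2)) K →ₗ[K] K}
    (hℓ₀ : ∀ p, ℓ₀ (homogeneousComponent ((2 * k₀ + 2) * (d - 2)) p) = ℓ₀ p)
    (hJ₀ : annIdeal ℓ₀ = jacobianIdeal (twoPlanesForm gA h gC Q P))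
    {ℓ : MvPolynomial (Fin (2 * (k₀ + m) + 2)) K →ₗ[K] K}
    (hℓ : ∀ p, ℓ (homogeneousComponent ((2 * (k₀ + m) + 2) * (d - 2)) p) = ℓ p)
    (hJ : annIdeal ℓ = jacobianIdeal (twoPlanesForm (coneGA m gA) (coneGA m h) (coneGC m gC) (coneQ m Q) (coneP m d P))) :
    ∃ ℓC : MvPolynomial (Fin m × Fin 2) K →ₗ[K] K, (∀ p, ℓC (homogeneousComponent (m * (d - 2)) p) = ℓC p) ∧
      ∀ a : ℕ,
        (excessSet (ciCycleFunctional ℓ (plane₁Gens κ (coneGA m gA) (coneGC m gC))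
            (plane₁Cofs κ (coneGA m h) (coneQ m Q) (coneP m d P)))
          (ciCycleFunctional ℓ (plane₂Gens κ (coneGA m h) (coneGC m gC))
            (plane₂Cofs κ (coneGA m gA) (coneQ m Q) (coneP m d P))) a).ncard =
          (excessSet
            (tensorFunctional (ciCycleFunctional ℓ₀ (plane₁Gens κ₀ gA gC) (plane₁Cofs κ₀ h Q P)) ℓC)
            (tensorFunctional (ciCycleFunctional ℓ₀ (plane₂Gens κ₀ h gC) (plane₂Cofs κ₀ gA Q P)) ℓC) a).ncard ∧
        ((excessSet (ciCycleFunctional ℓ (plane₁Gens κ (coneGA m gA) (coneGC m gC))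
            (plane₁Cofs κ (coneGA m h) (coneQ m Q) (coneP m d P)))
          (ciCycleFunctional ℓ (plane₂Gens κ (coneGA m h) (coneGC m gC))
            (plane₂Cofs κ (coneGA m gA) (coneQ m Q) (coneP m d P))) a).Finite ↔
          (excessSet
            (tensorFunctional (ciCycleFunctional ℓ₀ (plane₁Gens κ₀ gA gC) (plane₁Cofs κ₀ h Q P)) ℓC)
            (tensorFunctional (ciCycleFunctional ℓ₀ (plane₂Gens κ₀ h gC) (plane₂Cofs κ₀ gA Q P)) ℓC) a).Finite) := by
  have hd2 : 2 ≤ d := by omega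
  obtain ⟨N, hN, hXN⟩ := exists_X_pow_mem_jacobianIdeal_cone m d gA h gC Q P hd hN₀ hXN₀
  -- the socle functional of the block ideal `⟨y_i^{d−1}, z_i⟩_i`
  have hCAG := isArtinianGorenstein_blockJoin (K := K)
    (I := fun _ : Fin m => Ideal.span (Set.range (coneBlockGens (K := K) d)))
    (s := fun _ => d - 2) fun _ => isArtinianGorenstein_coneBlock hd2
  rw [Finset.sum_const, Finset.card_univ, Fintype.card_fin, smul_eq_mul] at hCAG
  obtain ⟨ℓC, hℓC, hCne, hC⟩ := hCAG.exists_eq_annIdeal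
  refine ⟨ℓC, hℓC, fun a => ?_⟩
  -- names
  set θ := coneVarEquiv k₀ m with hθ
  set ℓ₁₀ := ciCycleFunctional ℓ₀ (plane₁Gens κ₀ gA gC) (plane₁Cofs κ₀ h Q P) with hℓ₁₀
  set ℓ₂₀ := ciCycleFunctional ℓ₀ (plane₂Gens κ₀ h gC) (plane₂Cofs κ₀ gA Q P) with hℓ₂₀
  set ℓ₁ := ciCycleFunctional ℓ (plane₁Gens κ (coneGA m gA) (coneGC m gC))
    (plane₁Cofs κ (coneGA m h) (coneQ m Q) (coneP m d P)) with hℓ₁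
  set ℓ₂ := ciCycleFunctional ℓ (plane₂Gens κ (coneGA m h) (coneGC m gC))
    (plane₂Cofs κ (coneGA m gA) (coneQ m Q) (coneP m d P)) with hℓ₂
  -- plane 2 is plane 1 for the swapped data `(h, gA, Qᵀ)`
  have hQt : ∀ i j, (fun i j => Q j i) i j |>.IsHomogeneous (d - 2) := fun i j => hQ j i
  have hXN₀t : ∀ l, (X l : MvPolynomial (Fin (2 * k₀ + 2)) K) ^ N₀ ∈
      jacobianIdeal (twoPlanesForm h gA gC (fun i j => Q j i) P) := by
    rw [twoPlanesForm_swap]; exact hXN₀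
  have hJ₀t : annIdeal ℓ₀ = jacobianIdeal (twoPlanesForm h gA gC (fun i j => Q j i) P) := by
    rw [twoPlanesForm_swap]; exact hJ₀
  have hXNt : ∀ l, (X l : MvPolynomial (Fin (2 * (k₀ + m) + 2)) K) ^ N ∈
      jacobianIdeal (twoPlanesForm (coneGA m h) (coneGA m gA) (coneGC m gC) (coneQ m fun i j => Q j i) (coneP m d P)) := by
    rw [show (coneQ m fun i j => Q j i) = fun i j => coneQ (K := K) m Q j i from rfl, twoPlanesForm_swap]; exact hXN
  have hJt : annIdeal ℓ =
      jacobianIdeal (twoPlanesForm (coneGA m h) (coneGA m gA) (coneGC m gC) (coneQ m fun i j => Q j i) (coneP m d P)) := by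
    rw [show (coneQ m fun i j => Q j i) = fun i j => coneQ (K := K) m Q j i from rfl, twoPlanesForm_swap]; exact hJ
  have hE₁ : annIdeal ℓ₁ = (annIdeal (tensorFunctional ℓ₁₀ ℓC)).map
      (rename θ : MvPolynomial (Fin (2 * k₀ + 2) ⊕ (Fin m × Fin 2)) K →ₐ[K] MvPolynomial (Fin (2 * (k₀ + m) + 2)) K) :=
    annIdeal_cone_plane₁_eq_map hd2 hgA hh hgC hQ hP hN₀ hXN₀ hℓ₀ hJ₀ hN hXN hℓ hJ hℓC hCne hC.symm
  have hE₂ : annIdeal ℓ₂ = (annIdeal (tensorFunctional ℓ₂₀ ℓC)).map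
      (rename θ : MvPolynomial (Fin (2 * k₀ + 2) ⊕ (Fin m × Fin 2)) K →ₐ[K] MvPolynomial (Fin (2 * (k₀ + m) + 2)) K) :=
    annIdeal_cone_plane₁_eq_map (κ₀ := κ₀) (κ := κ) hd2 hh hgA hgC hQt hP hN₀ hXN₀t hℓ₀ hJ₀t hN hXNt hℓ hJt hℓC hCne
      hC.symm
  -- degrees and non-vanishing
  have hc₁₀ : ∀ p, ℓ₁₀ (homogeneousComponent ((k₀ + 1) * (d - 2)) p) = ℓ₁₀ p :=
    ciCycleFunctional_plane₁_homogeneousComponent hd2 hgA hh hgC hQ hP hℓ₀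
  have hc₂₀ : ∀ p, ℓ₂₀ (homogeneousComponent ((k₀ + 1) * (d - 2)) p) = ℓ₂₀ p :=
    ciCycleFunctional_plane₂_homogeneousComponent hd2 hgA hh hgC hQ hP hℓ₀
  have hgA' : ∀ i, (coneGA m gA i).IsHomogeneous 1 := isHomogeneous_coneGA hgA
  have hh' : ∀ j, (coneGA m h j).IsHomogeneous 1 := isHomogeneous_coneGA hh
  have hgC' : ∀ l, (coneGC m gC l).IsHomogeneous 1 := isHomogeneous_coneGC hgC
  have hQ' : ∀ i j, (coneQ m Q i j).IsHomogeneous (d - 2) := isHomogeneous_coneQ hQ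
  have hP' : ∀ l, (coneP m d P l).IsHomogeneous (d - 1) := isHomogeneous_coneP hP
  have hXN' : ∀ l, (X l : MvPolynomial (Fin (2 * (k₀ + m) + 2)) K) ^ N ∈
      jacobianIdeal (∑ i, plane₁Gens κ (coneGA m gA) (coneGC m gC) i *
        plane₁Cofs κ (coneGA m h) (coneQ m Q) (coneP m d P) i) := by
    rw [sum_plane₁Gens_mul_plane₁Cofs]; exact hXN
  have hJ' : annIdeal ℓ = jacobianIdeal (∑ i, plane₁Gens κ (coneGA m gA) (coneGC m gC) i *
      plane₁Cofs κ (coneGA m h) (coneQ m Q) (coneP m d P) i) := by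
    rw [sum_plane₁Gens_mul_plane₁Cofs]; exact hJ
  have hXN'' : ∀ l, (X l : MvPolynomial (Fin (2 * (k₀ + m) + 2)) K) ^ N ∈
      jacobianIdeal (∑ i, plane₂Gens κ (coneGA m h) (coneGC m gC) i *
        plane₂Cofs κ (coneGA m gA) (coneQ m Q) (coneP m d P) i) := by
    rw [sum_plane₂Gens_mul_plane₂Cofs]; exact hXN
  have hJ'' : annIdeal ℓ = jacobianIdeal (∑ i, plane₂Gens κ (coneGA m h) (coneGC m gC) i *
      plane₂Cofs κ (coneGA m gA) (coneQ m Q) (coneP m d P) i) := by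
    rw [sum_plane₂Gens_mul_plane₂Cofs]; exact hJ
  have hc₁ : ∀ p, ℓ₁ (homogeneousComponent ((k₀ + m + 1) * (d - 2)) p) = ℓ₁ p :=
    ciCycleFunctional_homogeneousComponent (plane₁Gens κ (coneGA m gA) (coneGC m gC))
      (plane₁Cofs κ (coneGA m h) (coneQ m Q) (coneP m d P)) (fun _ => 1) (fun _ => d - 1)
      (isHomogeneous_plane₁Gens κ hgA' hgC') (isHomogeneous_plane₁Cofs κ hd2 hh' hQ' hP') (fun _ => Nat.one_pos)
      (fun _ => by omega) (fun _ => by omega) hℓ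
  have hc₂ : ∀ p, ℓ₂ (homogeneousComponent ((k₀ + m + 1) * (d - 2)) p) = ℓ₂ p :=
    ciCycleFunctional_homogeneousComponent (plane₂Gens κ (coneGA m h) (coneGC m gC))
      (plane₂Cofs κ (coneGA m gA) (coneQ m Q) (coneP m d P)) (fun _ => 1) (fun _ => d - 1)
      (isHomogeneous_plane₂Gens κ hh' hgC') (isHomogeneous_plane₂Cofs κ hd2 hgA' hQ' hP') (fun _ => Nat.one_pos)
      (fun _ => by omega) (fun _ => by omega) hℓ
  have hn₁ : ℓ₁ ≠ 0 :=
    ciCycleFunctional_ne_zero (d := d) (plane₁Gens κ (coneGA m gA) (coneGC m gC))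
      (plane₁Cofs κ (coneGA m h) (coneQ m Q) (coneP m d P)) (fun _ => 1) (fun _ => d - 1)
      (isHomogeneous_plane₁Gens κ hgA' hgC') (isHomogeneous_plane₁Cofs κ hd2 hh' hQ' hP') (fun _ => Nat.one_pos)
      (fun _ => by omega) (fun _ => by omega) hN hXN' hJ'
  have hn₂ : ℓ₂ ≠ 0 :=
    ciCycleFunctional_ne_zero (d := d) (plane₂Gens κ (coneGA m h) (coneGC m gC))
      (plane₂Cofs κ (coneGA m gA) (coneQ m Q) (coneP m d P)) (fun _ => 1) (fun _ => d - 1)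
      (isHomogeneous_plane₂Gens κ hh' hgC') (isHomogeneous_plane₂Cofs κ hd2 hgA' hQ' hP') (fun _ => Nat.one_pos)
      (fun _ => by omega) (fun _ => by omega) hN hXN'' hJ''
  -- the pulled-back cone functionals `L'_j = ℓ_j ∘ rename θ` are socle functionals of the joins `I(ℓ⁰_j ⊗ ℓ_C)`
  set L₁ := tensorFunctional ℓ₁₀ ℓC with hL₁
  set L₂ := tensorFunctional ℓ₂₀ ℓC with hL₂
  set L₁' := ℓ₁ ∘ₗ (rename θ : MvPolynomial (Fin (2 * k₀ + 2) ⊕ (Fin m × Fin 2)) K →ₐ[K]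
    MvPolynomial (Fin (2 * (k₀ + m) + 2)) K).toLinearMap with hL₁'
  set L₂' := ℓ₂ ∘ₗ (rename θ : MvPolynomial (Fin (2 * k₀ + 2) ⊕ (Fin m × Fin 2)) K →ₐ[K]
    MvPolynomial (Fin (2 * (k₀ + m) + 2)) K).toLinearMap with hL₂'
  have hdeg : (k₀ + 1) * (d - 2) + m * (d - 2) = (k₀ + m + 1) * (d - 2) := by ring
  have hcL₁ : ∀ p, L₁ (homogeneousComponent ((k₀ + m + 1) * (d - 2)) p) = L₁ p := by
    rw [← hdeg]; exact tensorFunctional_homogeneousComponent hc₁₀ hℓC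
  have hcL₂ : ∀ p, L₂ (homogeneousComponent ((k₀ + m + 1) * (d - 2)) p) = L₂ p := by
    rw [← hdeg]; exact tensorFunctional_homogeneousComponent hc₂₀ hℓC
  have hcL₁' : ∀ p, L₁' (homogeneousComponent ((k₀ + m + 1) * (d - 2)) p) = L₁' p :=
    comp_rename_homogeneousComponent' _ _ θ.symm hc₁
  have hcL₂' : ∀ p, L₂' (homogeneousComponent ((k₀ + m + 1) * (d - 2)) p) = L₂' p :=
    comp_rename_homogeneousComponent' _ _ θ.symm hc₂
  have hnL₁' : L₁' ≠ 0 := comp_rename_ne_zero' _ _ θ hn₁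
  have hnL₂' : L₂' ≠ 0 := comp_rename_ne_zero' _ _ θ hn₂
  have haL₁' : annIdeal L₁' = annIdeal L₁ := by
    rw [hL₁', show (rename θ : MvPolynomial (Fin (2 * k₀ + 2) ⊕ (Fin m × Fin 2)) K →ₐ[K]
        MvPolynomial (Fin (2 * (k₀ + m) + 2)) K) = rename θ.symm.symm from rfl, annIdeal_comp_rename_symm, hE₁,
      map_rename_map_rename_symm']
  have haL₂' : annIdeal L₂' = annIdeal L₂ := by
    rw [hL₂', show (rename θ : MvPolynomial (Fin (2 * k₀ + 2) ⊕ (Fin m × Fin 2)) K →ₐ[K]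
        MvPolynomial (Fin (2 * (k₀ + m) + 2)) K) = rename θ.symm.symm from rfl, annIdeal_comp_rename_symm, hE₂,
      map_rename_map_rename_symm']
  have hcard := ncard_excessSet_eq_of_annIdeal_eq hcL₁ hcL₂ hcL₁' hcL₂' hnL₁' hnL₂' haL₁' haL₂' a
  have hsame : excessSet L₁' L₂' a = excessSet ℓ₁ ℓ₂ a := excessSet_comp_rename_symm θ.symm ℓ₁ ℓ₂ a
  rw [hsame] at hcard
  exact hcard

/-- **Theorem 4.9 (induction step), the count with no hypothesis on the lower degrees: "In particular the number of `λ`,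
where the rank drops, does not increase."** In the situation of the tree's `excessSet_cone` (Kloosterman's normal form,
`d ≥ 3`, characteristic `0`, `ℓ₀`/`ℓ` socle functionals of `J^f`/`J^{f̃}` for the `m`-fold cone `f̃`), for every degree
`a ≤ (k₀+1)(d−2)`: if `E_a(ℓ⁰₁,ℓ⁰₂)` is finite then `E_a(ℓ₁,ℓ₂)` is finite and `#E_a(ℓ₁,ℓ₂) ≤ #E_a(ℓ⁰₁,ℓ⁰₂)`. (The tree's
`excessSet_cone` (2) assumed in addition `E_{a'}(ℓ⁰₁,ℓ⁰₂) = ∅` for `a' < a`; by `excessSet_mono` the lower exceptional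
sets lie inside `E_a` and no such hypothesis is needed.) This is the step of the proof of [KloMN, Thm. 4.8]
(`X_{k,d}` is the `(k−2)`-fold cone of `X_{2,d}`: two exceptional values for every `k` once there are two for `k = 2`).
[cite: Kloosterman2025, Theorem 4.9 (proof), Proposition 4.7] [cite: Kloosterman2025CodimOne, Theorem 4.8 (proof)] -/
theorem ncard_excessSet_cone_le [CharZero K] (hd : 3 ≤ d)
    (hgA : ∀ i, (gA i).IsHomogeneous 1) (hh : ∀ j, (h j).IsHomogeneous 1) (hgC : ∀ l, (gC l).IsHomogeneous 1)
    (hQ : ∀ i j, (Q i j).IsHomogeneous (d - 2)) (hP : ∀ l, (P l).IsHomogeneous (d - 1))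
    {N₀ : ℕ} (hN₀ : 0 < N₀)
    (hXN₀ : ∀ l, (X l : MvPolynomial (Fin (2 * k₀ + 2)) K) ^ N₀ ∈ jacobianIdeal (twoPlanesForm gA h gC Q P))
    {ℓ₀ : MvPolynomial (Fin (2 * k₀ + 2)) K →ₗ[K] K}
    (hℓ₀ : ∀ p, ℓ₀ (homogeneousComponent ((2 * k₀ + 2) * (d - 2)) p) = ℓ₀ p)
    (hJ₀ : annIdeal ℓ₀ = jacobianIdeal (twoPlanesForm gA h gC Q P))
    {ℓ : MvPolynomial (Fin (2 * (k₀ + m) + 2)) K →ₗ[K] K}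
    (hℓ : ∀ p, ℓ (homogeneousComponent ((2 * (k₀ + m) + 2) * (d - 2)) p) = ℓ p)
    (hJ : annIdeal ℓ = jacobianIdeal (twoPlanesForm (coneGA m gA) (coneGA m h) (coneGC m gC) (coneQ m Q) (coneP m d P)))
    {a : ℕ} (ha : a ≤ (k₀ + 1) * (d - 2))
    (hfin : (excessSet (ciCycleFunctional ℓ₀ (plane₁Gens κ₀ gA gC) (plane₁Cofs κ₀ h Q P))
      (ciCycleFunctional ℓ₀ (plane₂Gens κ₀ h gC) (plane₂Cofs κ₀ gA Q P)) a).Finite) :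
    (excessSet (ciCycleFunctional ℓ (plane₁Gens κ (coneGA m gA) (coneGC m gC))
          (plane₁Cofs κ (coneGA m h) (coneQ m Q) (coneP m d P)))
        (ciCycleFunctional ℓ (plane₂Gens κ (coneGA m h) (coneGC m gC))
          (plane₂Cofs κ (coneGA m gA) (coneQ m Q) (coneP m d P))) a).Finite ∧
      (excessSet (ciCycleFunctional ℓ (plane₁Gens κ (coneGA m gA) (coneGC m gC))
          (plane₁Cofs κ (coneGA m h) (coneQ m Q) (coneP m d P)))
        (ciCycleFunctional ℓ (plane₂Gens κ (coneGA m h) (coneGC m gC))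
          (plane₂Cofs κ (coneGA m gA) (coneQ m Q) (coneP m d P))) a).ncard ≤
      (excessSet (ciCycleFunctional ℓ₀ (plane₁Gens κ₀ gA gC) (plane₁Cofs κ₀ h Q P))
        (ciCycleFunctional ℓ₀ (plane₂Gens κ₀ h gC) (plane₂Cofs κ₀ gA Q P)) a).ncard := by
  have hd2 : 2 ≤ d := by omega
  obtain ⟨ℓC, hℓC, H⟩ := exists_excessSet_cone_eq_tensor (κ₀ := κ₀) (κ := κ) hd hgA hh hgC hQ hP hN₀ hXN₀ hℓ₀ hJ₀ hℓ hJ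
  obtain ⟨hcard, hfinite⟩ := H a
  have hc₁₀ := ciCycleFunctional_plane₁_homogeneousComponent (κ₀ := κ₀) hd2 hgA hh hgC hQ hP hℓ₀
  have hc₂₀ := ciCycleFunctional_plane₂_homogeneousComponent (κ₀ := κ₀) hd2 hgA hh hgC hQ hP hℓ₀
  obtain ⟨hfinJ, hleJ⟩ := ncard_excessSet_tensorFunctional_le hc₁₀ hc₂₀ hℓC ha hfin
  rw [hcard]
  exact ⟨hfinite.mpr hfinJ, hleJ⟩

/-- … and in EVERY degree `a`, with `E_{min(a,(k₀+1)(d−2))}` of the base on the right: if that set is finite, `E_a` of the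
cone is finite with at most as many elements. [cite: Kloosterman2025, Theorem 4.9 (proof), Proposition 4.7] -/
theorem ncard_excessSet_cone_le_min [CharZero K] (hd : 3 ≤ d)
    (hgA : ∀ i, (gA i).IsHomogeneous 1) (hh : ∀ j, (h j).IsHomogeneous 1) (hgC : ∀ l, (gC l).IsHomogeneous 1)
    (hQ : ∀ i j, (Q i j).IsHomogeneous (d - 2)) (hP : ∀ l, (P l).IsHomogeneous (d - 1))
    {N₀ : ℕ} (hN₀ : 0 < N₀)
    (hXN₀ : ∀ l, (X l : MvPolynomial (Fin (2 * k₀ + 2)) K) ^ N₀ ∈ jacobianIdeal (twoPlanesForm gA h gC Q P))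
    {ℓ₀ : MvPolynomial (Fin (2 * k₀ + 2)) K →ₗ[K] K}
    (hℓ₀ : ∀ p, ℓ₀ (homogeneousComponent ((2 * k₀ + 2) * (d - 2)) p) = ℓ₀ p)
    (hJ₀ : annIdeal ℓ₀ = jacobianIdeal (twoPlanesForm gA h gC Q P))
    {ℓ : MvPolynomial (Fin (2 * (k₀ + m) + 2)) K →ₗ[K] K}
    (hℓ : ∀ p, ℓ (homogeneousComponent ((2 * (k₀ + m) + 2) * (d - 2)) p) = ℓ p)
    (hJ : annIdeal ℓ = jacobianIdeal (twoPlanesForm (coneGA m gA) (coneGA m h) (coneGC m gC) (coneQ m Q) (coneP m d P)))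
    (a : ℕ)
    (hfin : (excessSet (ciCycleFunctional ℓ₀ (plane₁Gens κ₀ gA gC) (plane₁Cofs κ₀ h Q P))
      (ciCycleFunctional ℓ₀ (plane₂Gens κ₀ h gC) (plane₂Cofs κ₀ gA Q P)) (min a ((k₀ + 1) * (d - 2)))).Finite) :
    (excessSet (ciCycleFunctional ℓ (plane₁Gens κ (coneGA m gA) (coneGC m gC))
          (plane₁Cofs κ (coneGA m h) (coneQ m Q) (coneP m d P)))
        (ciCycleFunctional ℓ (plane₂Gens κ (coneGA m h) (coneGC m gC))
          (plane₂Cofs κ (coneGA m gA) (coneQ m Q) (coneP m d P))) a).Finite ∧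
      (excessSet (ciCycleFunctional ℓ (plane₁Gens κ (coneGA m gA) (coneGC m gC))
          (plane₁Cofs κ (coneGA m h) (coneQ m Q) (coneP m d P)))
        (ciCycleFunctional ℓ (plane₂Gens κ (coneGA m h) (coneGC m gC))
          (plane₂Cofs κ (coneGA m gA) (coneQ m Q) (coneP m d P))) a).ncard ≤
      (excessSet (ciCycleFunctional ℓ₀ (plane₁Gens κ₀ gA gC) (plane₁Cofs κ₀ h Q P))
        (ciCycleFunctional ℓ₀ (plane₂Gens κ₀ h gC) (plane₂Cofs κ₀ gA Q P)) (min a ((k₀ + 1) * (d - 2)))).ncard := by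
  have hd2 : 2 ≤ d := by omega
  obtain ⟨ℓC, hℓC, H⟩ := exists_excessSet_cone_eq_tensor (κ₀ := κ₀) (κ := κ) hd hgA hh hgC hQ hP hN₀ hXN₀ hℓ₀ hJ₀ hℓ hJ
  obtain ⟨hcard, hfinite⟩ := H a
  have hc₁₀ := ciCycleFunctional_plane₁_homogeneousComponent (κ₀ := κ₀) hd2 hgA hh hgC hQ hP hℓ₀
  have hc₂₀ := ciCycleFunctional_plane₂_homogeneousComponent (κ₀ := κ₀) hd2 hgA hh hgC hQ hP hℓ₀
  have hsub := excessSet_tensorFunctional_subset_min hc₁₀ hc₂₀ hℓC a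
  rw [hcard]
  exact ⟨hfinite.mpr (hfin.subset hsub), Set.ncard_le_ncard hsub hfin⟩

/-- **Finiteness goes both ways below the socle degree of the base**: for `a ≤ (k₀+1)(d−2)`, `E_a` of the cone is
finite iff `E_a` of the base is (the join also contains every witness of the base: `E_a(ℓ⁰₁,ℓ⁰₂) = E_a` of the pair
`ℓ⁰_j ⊗ ℓ_C` restricted … — here only the implication base ⇒ cone and the tree's (1) are combined: if ALL `E_{a'}`,
`a' ≤ a`, of the base are finite then so is `E_a` of the cone, and by `excessSet_mono` "all `a' ≤ a`" is the single
condition at `a`). [cite: Kloosterman2025, Theorem 4.9 (proof), Proposition 4.7] -/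
theorem excessSet_cone_finite_of_le [CharZero K] (hd : 3 ≤ d)
    (hgA : ∀ i, (gA i).IsHomogeneous 1) (hh : ∀ j, (h j).IsHomogeneous 1) (hgC : ∀ l, (gC l).IsHomogeneous 1)
    (hQ : ∀ i j, (Q i j).IsHomogeneous (d - 2)) (hP : ∀ l, (P l).IsHomogeneous (d - 1))
    {N₀ : ℕ} (hN₀ : 0 < N₀)
    (hXN₀ : ∀ l, (X l : MvPolynomial (Fin (2 * k₀ + 2)) K) ^ N₀ ∈ jacobianIdeal (twoPlanesForm gA h gC Q P))
    {ℓ₀ : MvPolynomial (Fin (2 * k₀ + 2)) K →ₗ[K] K}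
    (hℓ₀ : ∀ p, ℓ₀ (homogeneousComponent ((2 * k₀ + 2) * (d - 2)) p) = ℓ₀ p)
    (hJ₀ : annIdeal ℓ₀ = jacobianIdeal (twoPlanesForm gA h gC Q P))
    {ℓ : MvPolynomial (Fin (2 * (k₀ + m) + 2)) K →ₗ[K] K}
    (hℓ : ∀ p, ℓ (homogeneousComponent ((2 * (k₀ + m) + 2) * (d - 2)) p) = ℓ p)
    (hJ : annIdeal ℓ = jacobianIdeal (twoPlanesForm (coneGA m gA) (coneGA m h) (coneGC m gC) (coneQ m Q) (coneP m d P)))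
    (a : ℕ)
    (hfin : (excessSet (ciCycleFunctional ℓ₀ (plane₁Gens κ₀ gA gC) (plane₁Cofs κ₀ h Q P))
      (ciCycleFunctional ℓ₀ (plane₂Gens κ₀ h gC) (plane₂Cofs κ₀ gA Q P)) ((k₀ + 1) * (d - 2))).Finite) :
    (excessSet (ciCycleFunctional ℓ (plane₁Gens κ (coneGA m gA) (coneGC m gC))
          (plane₁Cofs κ (coneGA m h) (coneQ m Q) (coneP m d P)))
        (ciCycleFunctional ℓ (plane₂Gens κ (coneGA m h) (coneGC m gC))
          (plane₂Cofs κ (coneGA m gA) (coneQ m Q) (coneP m d P))) a).Finite := by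
  have hd2 : 2 ≤ d := by omega
  have hc₁₀ := ciCycleFunctional_plane₁_homogeneousComponent (κ₀ := κ₀) hd2 hgA hh hgC hQ hP hℓ₀
  have hc₂₀ := ciCycleFunctional_plane₂_homogeneousComponent (κ₀ := κ₀) hd2 hgA hh hgC hQ hP hℓ₀
  have hfin' := hfin.subset (excessSet_mono hc₁₀ hc₂₀ (min_le_right a _) le_rfl)
  exact (ncard_excessSet_cone_le_min (κ₀ := κ₀) (κ := κ) hd hgA hh hgC hQ hP hN₀ hXN₀ hℓ₀ hJ₀ hℓ hJ a hfin').1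

end Cone

/-! ## Addendum: exceptional values PERSIST along joins and cones — the exact count of [Klo25, Prop. 4.7 / Thm. 4.9]

Kloosterman's Proposition 4.7 is an EQUALITY of left-kernel dimensions (the pencil of the cone is a direct sum of
pencils of the base); the tree so far used only the inequality `#E_a(cone) ≤ #E_a(base)`. The reverse inequality is
elementary: a witness `w` of an exceptional value `c` of the base (`w ∈ I(ℓ₁ + cℓ₂)_a ∖ (I₁ ∩ I₂)`) is, read in the
bigger polynomial ring, a witness for the join `ℓ_j ⊗ ℓ_C` (`(ℓ ⊗ ℓ_C)(w·p(x)q(y)) = ℓ(wp)ℓ_C(q)`), for ANY non-zero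
functional `ℓ_C` on the new variables. Hence `E_a(ℓ₁,ℓ₂) ⊆ E_a(ℓ₁ ⊗ ℓ_C, ℓ₂ ⊗ ℓ_C)` and, for the cone,
`#E_a(cone) = #E_a(base)` whenever the latter is finite (`a ≤ (k₀+1)(d−2)`). -/

section Persistence

open DuqueFrancoVillaflor2025

variable {K : Type*} [Field K] {σ τ : Type*}

/-- **Exceptional values persist along joins.** For ANY non-zero functional `ℓ_C` on a disjoint set of variables and
every degree `a`: `E_a(ℓ₁,ℓ₂) ⊆ E_a(ℓ₁ ⊗ ℓ_C, ℓ₂ ⊗ ℓ_C)` — a witness `w ∈ I(ℓ₁ + cℓ₂)_a ∖ (I(ℓ₁) ∩ I(ℓ₂))` stays a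
witness in `K[x ⊔ y]`: `I(ℓ)·S ⊆ I(ℓ ⊗ ℓ_C)` (tree `map_rename_inl_annIdeal_le`), and `(ℓ_j ⊗ ℓ_C)(w·p(x)q(y)) =
ℓ_j(wp)·ℓ_C(q) ≠ 0` for suitable `p, q`. This is the elementary half of the equality in Proposition 4.7 ("the
dimension of the left kernel … equals the sum …": the summand `δ' = δ`). [cite: Kloosterman2025, Proposition 4.7] -/
theorem excessSet_subset_excessSet_tensorFunctional (ℓ₁ ℓ₂ : MvPolynomial σ K →ₗ[K] K)
    {ℓC : MvPolynomial τ K →ₗ[K] K} (hC : ℓC ≠ 0) (a : ℕ) :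
    excessSet ℓ₁ ℓ₂ a ⊆ excessSet (tensorFunctional ℓ₁ ℓC) (tensorFunctional ℓ₂ ℓC) a := by
  intro c hc
  obtain ⟨hc0, w, hw, hwin, hwout⟩ := mem_excessSet_iff_exists.mp hc
  refine mem_excessSet_iff_exists.mpr ⟨hc0, rename Sum.inl w, hw.rename_isHomogeneous, ?_, ?_⟩
  · rw [← tensorFunctional_add_smul]
    exact map_rename_inl_annIdeal_le _ _ (Ideal.mem_map_of_mem _ hwin)
  · intro hmem
    apply hwout
    obtain ⟨q, hq⟩ : ∃ q, ℓC q ≠ 0 :=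
      not_forall.mp fun hq => hC (LinearMap.ext fun q => hq q)
    have key : ∀ {ℓ : MvPolynomial σ K →ₗ[K] K},
        rename Sum.inl w ∈ annIdeal (tensorFunctional ℓ ℓC) → w ∈ annIdeal ℓ := by
      intro ℓ h p
      have h' := mem_annIdeal_iff.mp h (rename Sum.inl p * rename Sum.inr q)
      rw [← mul_assoc, ← map_mul, tensorFunctional_mul_rename] at h'
      exact (mul_eq_zero.mp h').resolve_right hq
    exact Ideal.mem_inf.mpr ⟨key (Ideal.mem_inf.mp hmem).1, key (Ideal.mem_inf.mp hmem).2⟩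

/-- Hence, if `E_a(ℓ₁ ⊗ ℓ_C, ℓ₂ ⊗ ℓ_C)` is finite, so is `E_a(ℓ₁,ℓ₂)`, and `#E_a(ℓ₁,ℓ₂) ≤ #E_a(ℓ₁ ⊗ ℓ_C, ℓ₂ ⊗ ℓ_C)`.
[cite: Kloosterman2025, Proposition 4.7] -/
theorem ncard_excessSet_le_tensorFunctional (ℓ₁ ℓ₂ : MvPolynomial σ K →ₗ[K] K)
    {ℓC : MvPolynomial τ K →ₗ[K] K} (hC : ℓC ≠ 0) (a : ℕ)
    (hfin : (excessSet (tensorFunctional ℓ₁ ℓC) (tensorFunctional ℓ₂ ℓC) a).Finite) :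
    (excessSet ℓ₁ ℓ₂ a).Finite ∧
      (excessSet ℓ₁ ℓ₂ a).ncard ≤ (excessSet (tensorFunctional ℓ₁ ℓC) (tensorFunctional ℓ₂ ℓC) a).ncard :=
  ⟨hfin.subset (excessSet_subset_excessSet_tensorFunctional ℓ₁ ℓ₂ hC a),
    Set.ncard_le_ncard (excessSet_subset_excessSet_tensorFunctional ℓ₁ ℓ₂ hC a) hfin⟩

end Persistence

section ConeExact

open DuqueFrancoVillaflor2025 HodgeTheory Motives.UniversalHypersurface

variable {K : Type*} [Field K] {k₀ c r₀ : ℕ}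
  {m d : ℕ} {κ₀ : Fin c ⊕ Fin r₀ ≃ Fin (k₀ + 1)} {κ : Fin c ⊕ Fin (r₀ + m) ≃ Fin (k₀ + m + 1)}
  {gA h : Fin c → MvPolynomial (Fin (2 * k₀ + 2)) K} {gC : Fin r₀ → MvPolynomial (Fin (2 * k₀ + 2)) K}
  {Q : Fin c → Fin c → MvPolynomial (Fin (2 * k₀ + 2)) K} {P : Fin r₀ → MvPolynomial (Fin (2 * k₀ + 2)) K}

/-- The bookkeeping of `exists_excessSet_cone_eq_tensor` for a GIVEN socle functional `ℓ_C` of the block ideal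
`⊕_i ⟨y_i^{d−1}, z_i⟩` (so that its non-vanishing can be used afterwards): for every degree `a`,
`#E_a(cone) = #E_a(ℓ⁰₁ ⊗ ℓ_C, ℓ⁰₂ ⊗ ℓ_C)` and the two sets are finite together. [cite: Kloosterman2025, Proposition 4.7] -/
theorem excessSet_cone_ncard_eq_tensor [CharZero K] (hd : 3 ≤ d)
    (hgA : ∀ i, (gA i).IsHomogeneous 1) (hh : ∀ j, (h j).IsHomogeneous 1) (hgC : ∀ l, (gC l).IsHomogeneous 1)
    (hQ : ∀ i j, (Q i j).IsHomogeneous (d - 2)) (hP : ∀ l, (P l).IsHomogeneous (d - 1))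
    {N₀ : ℕ} (hN₀ : 0 < N₀)
    (hXN₀ : ∀ l, (X l : MvPolynomial (Fin (2 * k₀ + 2)) K) ^ N₀ ∈ jacobianIdeal (twoPlanesForm gA h gC Q P))
    {ℓ₀ : MvPolynomial (Fin (2 * k₀ + 2)) K →ₗ[K] K}
    (hℓ₀ : ∀ p, ℓ₀ (homogeneousComponent ((2 * k₀ + 2) * (d - 2)) p) = ℓ₀ p)
    (hJ₀ : annIdeal ℓ₀ = jacobianIdeal (twoPlanesForm gA h gC Q P))
    {ℓ : MvPolynomial (Fin (2 * (k₀ + m) + 2)) K →ₗ[K] K}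
    (hℓ : ∀ p, ℓ (homogeneousComponent ((2 * (k₀ + m) + 2) * (d - 2)) p) = ℓ p)
    (hJ : annIdeal ℓ = jacobianIdeal (twoPlanesForm (coneGA m gA) (coneGA m h) (coneGC m gC) (coneQ m Q) (coneP m d P)))
    {ℓC : MvPolynomial (Fin m × Fin 2) K →ₗ[K] K} (hℓC : ∀ p, ℓC (homogeneousComponent (m * (d - 2)) p) = ℓC p)
    (hCne : ℓC ≠ 0) (hC : annIdeal ℓC = blockJoin fun _ : Fin m => Ideal.span (Set.range (coneBlockGens (K := K) d)))
    (a : ℕ) :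
    (excessSet (ciCycleFunctional ℓ (plane₁Gens κ (coneGA m gA) (coneGC m gC))
        (plane₁Cofs κ (coneGA m h) (coneQ m Q) (coneP m d P)))
      (ciCycleFunctional ℓ (plane₂Gens κ (coneGA m h) (coneGC m gC))
        (plane₂Cofs κ (coneGA m gA) (coneQ m Q) (coneP m d P))) a).ncard =
      (excessSet
        (tensorFunctional (ciCycleFunctional ℓ₀ (plane₁Gens κ₀ gA gC) (plane₁Cofs κ₀ h Q P)) ℓC)
        (tensorFunctional (ciCycleFunctional ℓ₀ (plane₂Gens κ₀ h gC) (plane₂Cofs κ₀ gA Q P)) ℓC) a).ncard ∧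
    ((excessSet (ciCycleFunctional ℓ (plane₁Gens κ (coneGA m gA) (coneGC m gC))
        (plane₁Cofs κ (coneGA m h) (coneQ m Q) (coneP m d P)))
      (ciCycleFunctional ℓ (plane₂Gens κ (coneGA m h) (coneGC m gC))
        (plane₂Cofs κ (coneGA m gA) (coneQ m Q) (coneP m d P))) a).Finite ↔
      (excessSet
        (tensorFunctional (ciCycleFunctional ℓ₀ (plane₁Gens κ₀ gA gC) (plane₁Cofs κ₀ h Q P)) ℓC)
        (tensorFunctional (ciCycleFunctional ℓ₀ (plane₂Gens κ₀ h gC) (plane₂Cofs κ₀ gA Q P)) ℓC) a).Finite) := by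
  have hd2 : 2 ≤ d := by omega
  obtain ⟨N, hN, hXN⟩ := exists_X_pow_mem_jacobianIdeal_cone m d gA h gC Q P hd hN₀ hXN₀
  have hC := hC.symm
  -- names
  set θ := coneVarEquiv k₀ m with hθ
  set ℓ₁₀ := ciCycleFunctional ℓ₀ (plane₁Gens κ₀ gA gC) (plane₁Cofs κ₀ h Q P) with hℓ₁₀
  set ℓ₂₀ := ciCycleFunctional ℓ₀ (plane₂Gens κ₀ h gC) (plane₂Cofs κ₀ gA Q P) with hℓ₂₀
  set ℓ₁ := ciCycleFunctional ℓ (plane₁Gens κ (coneGA m gA) (coneGC m gC))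
    (plane₁Cofs κ (coneGA m h) (coneQ m Q) (coneP m d P)) with hℓ₁
  set ℓ₂ := ciCycleFunctional ℓ (plane₂Gens κ (coneGA m h) (coneGC m gC))
    (plane₂Cofs κ (coneGA m gA) (coneQ m Q) (coneP m d P)) with hℓ₂
  -- plane 2 is plane 1 for the swapped data `(h, gA, Qᵀ)`
  have hQt : ∀ i j, (fun i j => Q j i) i j |>.IsHomogeneous (d - 2) := fun i j => hQ j i
  have hXN₀t : ∀ l, (X l : MvPolynomial (Fin (2 * k₀ + 2)) K) ^ N₀ ∈
      jacobianIdeal (twoPlanesForm h gA gC (fun i j => Q j i) P) := by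
    rw [twoPlanesForm_swap]; exact hXN₀
  have hJ₀t : annIdeal ℓ₀ = jacobianIdeal (twoPlanesForm h gA gC (fun i j => Q j i) P) := by
    rw [twoPlanesForm_swap]; exact hJ₀
  have hXNt : ∀ l, (X l : MvPolynomial (Fin (2 * (k₀ + m) + 2)) K) ^ N ∈
      jacobianIdeal (twoPlanesForm (coneGA m h) (coneGA m gA) (coneGC m gC) (coneQ m fun i j => Q j i) (coneP m d P)) := by
    rw [show (coneQ m fun i j => Q j i) = fun i j => coneQ (K := K) m Q j i from rfl, twoPlanesForm_swap]; exact hXN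
  have hJt : annIdeal ℓ =
      jacobianIdeal (twoPlanesForm (coneGA m h) (coneGA m gA) (coneGC m gC) (coneQ m fun i j => Q j i) (coneP m d P)) := by
    rw [show (coneQ m fun i j => Q j i) = fun i j => coneQ (K := K) m Q j i from rfl, twoPlanesForm_swap]; exact hJ
  have hE₁ : annIdeal ℓ₁ = (annIdeal (tensorFunctional ℓ₁₀ ℓC)).map
      (rename θ : MvPolynomial (Fin (2 * k₀ + 2) ⊕ (Fin m × Fin 2)) K →ₐ[K] MvPolynomial (Fin (2 * (k₀ + m) + 2)) K) :=
    annIdeal_cone_plane₁_eq_map hd2 hgA hh hgC hQ hP hN₀ hXN₀ hℓ₀ hJ₀ hN hXN hℓ hJ hℓC hCne hC.symm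
  have hE₂ : annIdeal ℓ₂ = (annIdeal (tensorFunctional ℓ₂₀ ℓC)).map
      (rename θ : MvPolynomial (Fin (2 * k₀ + 2) ⊕ (Fin m × Fin 2)) K →ₐ[K] MvPolynomial (Fin (2 * (k₀ + m) + 2)) K) :=
    annIdeal_cone_plane₁_eq_map (κ₀ := κ₀) (κ := κ) hd2 hh hgA hgC hQt hP hN₀ hXN₀t hℓ₀ hJ₀t hN hXNt hℓ hJt hℓC hCne
      hC.symm
  -- degrees and non-vanishing
  have hc₁₀ : ∀ p, ℓ₁₀ (homogeneousComponent ((k₀ + 1) * (d - 2)) p) = ℓ₁₀ p :=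
    ciCycleFunctional_plane₁_homogeneousComponent hd2 hgA hh hgC hQ hP hℓ₀
  have hc₂₀ : ∀ p, ℓ₂₀ (homogeneousComponent ((k₀ + 1) * (d - 2)) p) = ℓ₂₀ p :=
    ciCycleFunctional_plane₂_homogeneousComponent hd2 hgA hh hgC hQ hP hℓ₀
  have hgA' : ∀ i, (coneGA m gA i).IsHomogeneous 1 := isHomogeneous_coneGA hgA
  have hh' : ∀ j, (coneGA m h j).IsHomogeneous 1 := isHomogeneous_coneGA hh
  have hgC' : ∀ l, (coneGC m gC l).IsHomogeneous 1 := isHomogeneous_coneGC hgC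
  have hQ' : ∀ i j, (coneQ m Q i j).IsHomogeneous (d - 2) := isHomogeneous_coneQ hQ
  have hP' : ∀ l, (coneP m d P l).IsHomogeneous (d - 1) := isHomogeneous_coneP hP
  have hXN' : ∀ l, (X l : MvPolynomial (Fin (2 * (k₀ + m) + 2)) K) ^ N ∈
      jacobianIdeal (∑ i, plane₁Gens κ (coneGA m gA) (coneGC m gC) i *
        plane₁Cofs κ (coneGA m h) (coneQ m Q) (coneP m d P) i) := by
    rw [sum_plane₁Gens_mul_plane₁Cofs]; exact hXN
  have hJ' : annIdeal ℓ = jacobianIdeal (∑ i, plane₁Gens κ (coneGA m gA) (coneGC m gC) i *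
      plane₁Cofs κ (coneGA m h) (coneQ m Q) (coneP m d P) i) := by
    rw [sum_plane₁Gens_mul_plane₁Cofs]; exact hJ
  have hXN'' : ∀ l, (X l : MvPolynomial (Fin (2 * (k₀ + m) + 2)) K) ^ N ∈
      jacobianIdeal (∑ i, plane₂Gens κ (coneGA m h) (coneGC m gC) i *
        plane₂Cofs κ (coneGA m gA) (coneQ m Q) (coneP m d P) i) := by
    rw [sum_plane₂Gens_mul_plane₂Cofs]; exact hXN
  have hJ'' : annIdeal ℓ = jacobianIdeal (∑ i, plane₂Gens κ (coneGA m h) (coneGC m gC) i *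
      plane₂Cofs κ (coneGA m gA) (coneQ m Q) (coneP m d P) i) := by
    rw [sum_plane₂Gens_mul_plane₂Cofs]; exact hJ
  have hc₁ : ∀ p, ℓ₁ (homogeneousComponent ((k₀ + m + 1) * (d - 2)) p) = ℓ₁ p :=
    ciCycleFunctional_homogeneousComponent (plane₁Gens κ (coneGA m gA) (coneGC m gC))
      (plane₁Cofs κ (coneGA m h) (coneQ m Q) (coneP m d P)) (fun _ => 1) (fun _ => d - 1)
      (isHomogeneous_plane₁Gens κ hgA' hgC') (isHomogeneous_plane₁Cofs κ hd2 hh' hQ' hP') (fun _ => Nat.one_pos)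
      (fun _ => by omega) (fun _ => by omega) hℓ
  have hc₂ : ∀ p, ℓ₂ (homogeneousComponent ((k₀ + m + 1) * (d - 2)) p) = ℓ₂ p :=
    ciCycleFunctional_homogeneousComponent (plane₂Gens κ (coneGA m h) (coneGC m gC))
      (plane₂Cofs κ (coneGA m gA) (coneQ m Q) (coneP m d P)) (fun _ => 1) (fun _ => d - 1)
      (isHomogeneous_plane₂Gens κ hh' hgC') (isHomogeneous_plane₂Cofs κ hd2 hgA' hQ' hP') (fun _ => Nat.one_pos)
      (fun _ => by omega) (fun _ => by omega) hℓ
  have hn₁ : ℓ₁ ≠ 0 :=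
    ciCycleFunctional_ne_zero (d := d) (plane₁Gens κ (coneGA m gA) (coneGC m gC))
      (plane₁Cofs κ (coneGA m h) (coneQ m Q) (coneP m d P)) (fun _ => 1) (fun _ => d - 1)
      (isHomogeneous_plane₁Gens κ hgA' hgC') (isHomogeneous_plane₁Cofs κ hd2 hh' hQ' hP') (fun _ => Nat.one_pos)
      (fun _ => by omega) (fun _ => by omega) hN hXN' hJ'
  have hn₂ : ℓ₂ ≠ 0 :=
    ciCycleFunctional_ne_zero (d := d) (plane₂Gens κ (coneGA m h) (coneGC m gC))
      (plane₂Cofs κ (coneGA m gA) (coneQ m Q) (coneP m d P)) (fun _ => 1) (fun _ => d - 1)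
      (isHomogeneous_plane₂Gens κ hh' hgC') (isHomogeneous_plane₂Cofs κ hd2 hgA' hQ' hP') (fun _ => Nat.one_pos)
      (fun _ => by omega) (fun _ => by omega) hN hXN'' hJ''
  -- the pulled-back cone functionals `L'_j = ℓ_j ∘ rename θ` are socle functionals of the joins `I(ℓ⁰_j ⊗ ℓ_C)`
  set L₁ := tensorFunctional ℓ₁₀ ℓC with hL₁
  set L₂ := tensorFunctional ℓ₂₀ ℓC with hL₂
  set L₁' := ℓ₁ ∘ₗ (rename θ : MvPolynomial (Fin (2 * k₀ + 2) ⊕ (Fin m × Fin 2)) K →ₐ[K]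
    MvPolynomial (Fin (2 * (k₀ + m) + 2)) K).toLinearMap with hL₁'
  set L₂' := ℓ₂ ∘ₗ (rename θ : MvPolynomial (Fin (2 * k₀ + 2) ⊕ (Fin m × Fin 2)) K →ₐ[K]
    MvPolynomial (Fin (2 * (k₀ + m) + 2)) K).toLinearMap with hL₂'
  have hdeg : (k₀ + 1) * (d - 2) + m * (d - 2) = (k₀ + m + 1) * (d - 2) := by ring
  have hcL₁ : ∀ p, L₁ (homogeneousComponent ((k₀ + m + 1) * (d - 2)) p) = L₁ p := by
    rw [← hdeg]; exact tensorFunctional_homogeneousComponent hc₁₀ hℓC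
  have hcL₂ : ∀ p, L₂ (homogeneousComponent ((k₀ + m + 1) * (d - 2)) p) = L₂ p := by
    rw [← hdeg]; exact tensorFunctional_homogeneousComponent hc₂₀ hℓC
  have hcL₁' : ∀ p, L₁' (homogeneousComponent ((k₀ + m + 1) * (d - 2)) p) = L₁' p :=
    comp_rename_homogeneousComponent' _ _ θ.symm hc₁
  have hcL₂' : ∀ p, L₂' (homogeneousComponent ((k₀ + m + 1) * (d - 2)) p) = L₂' p :=
    comp_rename_homogeneousComponent' _ _ θ.symm hc₂
  have hnL₁' : L₁' ≠ 0 := comp_rename_ne_zero' _ _ θ hn₁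
  have hnL₂' : L₂' ≠ 0 := comp_rename_ne_zero' _ _ θ hn₂
  have haL₁' : annIdeal L₁' = annIdeal L₁ := by
    rw [hL₁', show (rename θ : MvPolynomial (Fin (2 * k₀ + 2) ⊕ (Fin m × Fin 2)) K →ₐ[K]
        MvPolynomial (Fin (2 * (k₀ + m) + 2)) K) = rename θ.symm.symm from rfl, annIdeal_comp_rename_symm, hE₁,
      map_rename_map_rename_symm']
  have haL₂' : annIdeal L₂' = annIdeal L₂ := by
    rw [hL₂', show (rename θ : MvPolynomial (Fin (2 * k₀ + 2) ⊕ (Fin m × Fin 2)) K →ₐ[K]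
        MvPolynomial (Fin (2 * (k₀ + m) + 2)) K) = rename θ.symm.symm from rfl, annIdeal_comp_rename_symm, hE₂,
      map_rename_map_rename_symm']
  have hcard := ncard_excessSet_eq_of_annIdeal_eq hcL₁ hcL₂ hcL₁' hcL₂' hnL₁' hnL₂' haL₁' haL₂' a
  have hsame : excessSet L₁' L₂' a = excessSet ℓ₁ ℓ₂ a := excessSet_comp_rename_symm θ.symm ℓ₁ ℓ₂ a
  rw [hsame] at hcard
  exact hcard
/-- **Exceptional values persist along the cone**: if `E_a(ℓ₁,ℓ₂)` of the `m`-fold cone is finite, then `E_a(ℓ⁰₁,ℓ⁰₂)`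
of the base is finite and `#E_a(ℓ⁰₁,ℓ⁰₂) ≤ #E_a(ℓ₁,ℓ₂)`, in EVERY degree `a` (a witness of the base is a witness of
the cone). [cite: Kloosterman2025, Proposition 4.7] -/
theorem ncard_excessSet_cone_ge [CharZero K] (hd : 3 ≤ d)
    (hgA : ∀ i, (gA i).IsHomogeneous 1) (hh : ∀ j, (h j).IsHomogeneous 1) (hgC : ∀ l, (gC l).IsHomogeneous 1)
    (hQ : ∀ i j, (Q i j).IsHomogeneous (d - 2)) (hP : ∀ l, (P l).IsHomogeneous (d - 1))
    {N₀ : ℕ} (hN₀ : 0 < N₀)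
    (hXN₀ : ∀ l, (X l : MvPolynomial (Fin (2 * k₀ + 2)) K) ^ N₀ ∈ jacobianIdeal (twoPlanesForm gA h gC Q P))
    {ℓ₀ : MvPolynomial (Fin (2 * k₀ + 2)) K →ₗ[K] K}
    (hℓ₀ : ∀ p, ℓ₀ (homogeneousComponent ((2 * k₀ + 2) * (d - 2)) p) = ℓ₀ p)
    (hJ₀ : annIdeal ℓ₀ = jacobianIdeal (twoPlanesForm gA h gC Q P))
    {ℓ : MvPolynomial (Fin (2 * (k₀ + m) + 2)) K →ₗ[K] K}
    (hℓ : ∀ p, ℓ (homogeneousComponent ((2 * (k₀ + m) + 2) * (d - 2)) p) = ℓ p)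
    (hJ : annIdeal ℓ = jacobianIdeal (twoPlanesForm (coneGA m gA) (coneGA m h) (coneGC m gC) (coneQ m Q) (coneP m d P)))
    (a : ℕ)
    (hfin : (excessSet (ciCycleFunctional ℓ (plane₁Gens κ (coneGA m gA) (coneGC m gC))
        (plane₁Cofs κ (coneGA m h) (coneQ m Q) (coneP m d P)))
      (ciCycleFunctional ℓ (plane₂Gens κ (coneGA m h) (coneGC m gC))
        (plane₂Cofs κ (coneGA m gA) (coneQ m Q) (coneP m d P))) a).Finite) :
    (excessSet (ciCycleFunctional ℓ₀ (plane₁Gens κ₀ gA gC) (plane₁Cofs κ₀ h Q P))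
        (ciCycleFunctional ℓ₀ (plane₂Gens κ₀ h gC) (plane₂Cofs κ₀ gA Q P)) a).Finite ∧
      (excessSet (ciCycleFunctional ℓ₀ (plane₁Gens κ₀ gA gC) (plane₁Cofs κ₀ h Q P))
          (ciCycleFunctional ℓ₀ (plane₂Gens κ₀ h gC) (plane₂Cofs κ₀ gA Q P)) a).ncard ≤
        (excessSet (ciCycleFunctional ℓ (plane₁Gens κ (coneGA m gA) (coneGC m gC))
            (plane₁Cofs κ (coneGA m h) (coneQ m Q) (coneP m d P)))
          (ciCycleFunctional ℓ (plane₂Gens κ (coneGA m h) (coneGC m gC))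
            (plane₂Cofs κ (coneGA m gA) (coneQ m Q) (coneP m d P))) a).ncard := by
  have hd2 : 2 ≤ d := by omega
  -- the socle functional of the block ideal `⟨y_i^{d−1}, z_i⟩_i`, with its non-vanishing
  have hCAG := isArtinianGorenstein_blockJoin (K := K)
    (I := fun _ : Fin m => Ideal.span (Set.range (coneBlockGens (K := K) d)))
    (s := fun _ => d - 2) fun _ => isArtinianGorenstein_coneBlock hd2
  rw [Finset.sum_const, Finset.card_univ, Fintype.card_fin, smul_eq_mul] at hCAG
  obtain ⟨ℓC, hℓC, hCne, hC⟩ := hCAG.exists_eq_annIdeal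
  obtain ⟨hcard, hfinite⟩ := excessSet_cone_ncard_eq_tensor (κ₀ := κ₀) (κ := κ) hd hgA hh hgC hQ hP hN₀ hXN₀ hℓ₀
    hJ₀ hℓ hJ hℓC hCne hC.symm a
  obtain ⟨hfin₀, hle⟩ := ncard_excessSet_le_tensorFunctional _ _ hCne a (hfinite.mp hfin)
  exact ⟨hfin₀, hcard ▸ hle⟩

/-- **The count does not change along the cone** ([Klo25, Prop. 4.7], as used in the proofs of Thm. 4.9 and [KloMN]
Thm. 4.8): for `a ≤ (k₀+1)(d−2)`, if `E_a(ℓ⁰₁,ℓ⁰₂)` of the base is finite then `E_a(ℓ₁,ℓ₂)` of the `m`-fold cone is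
finite and `#E_a(ℓ₁,ℓ₂) = #E_a(ℓ⁰₁,ℓ⁰₂)` (`≤`: `ncard_excessSet_cone_le`; `≥`: persistence). [cite: Kloosterman2025,
Proposition 4.7, Theorem 4.9 (proof)] [cite: Kloosterman2025CodimOne, Theorem 4.8 (proof)] -/
theorem ncard_excessSet_cone_eq [CharZero K] (hd : 3 ≤ d)
    (hgA : ∀ i, (gA i).IsHomogeneous 1) (hh : ∀ j, (h j).IsHomogeneous 1) (hgC : ∀ l, (gC l).IsHomogeneous 1)
    (hQ : ∀ i j, (Q i j).IsHomogeneous (d - 2)) (hP : ∀ l, (P l).IsHomogeneous (d - 1))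
    {N₀ : ℕ} (hN₀ : 0 < N₀)
    (hXN₀ : ∀ l, (X l : MvPolynomial (Fin (2 * k₀ + 2)) K) ^ N₀ ∈ jacobianIdeal (twoPlanesForm gA h gC Q P))
    {ℓ₀ : MvPolynomial (Fin (2 * k₀ + 2)) K →ₗ[K] K}
    (hℓ₀ : ∀ p, ℓ₀ (homogeneousComponent ((2 * k₀ + 2) * (d - 2)) p) = ℓ₀ p)
    (hJ₀ : annIdeal ℓ₀ = jacobianIdeal (twoPlanesForm gA h gC Q P))
    {ℓ : MvPolynomial (Fin (2 * (k₀ + m) + 2)) K →ₗ[K] K}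
    (hℓ : ∀ p, ℓ (homogeneousComponent ((2 * (k₀ + m) + 2) * (d - 2)) p) = ℓ p)
    (hJ : annIdeal ℓ = jacobianIdeal (twoPlanesForm (coneGA m gA) (coneGA m h) (coneGC m gC) (coneQ m Q) (coneP m d P)))
    {a : ℕ} (ha : a ≤ (k₀ + 1) * (d - 2))
    (hfin : (excessSet (ciCycleFunctional ℓ₀ (plane₁Gens κ₀ gA gC) (plane₁Cofs κ₀ h Q P))
      (ciCycleFunctional ℓ₀ (plane₂Gens κ₀ h gC) (plane₂Cofs κ₀ gA Q P)) a).Finite) :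
    (excessSet (ciCycleFunctional ℓ (plane₁Gens κ (coneGA m gA) (coneGC m gC))
          (plane₁Cofs κ (coneGA m h) (coneQ m Q) (coneP m d P)))
        (ciCycleFunctional ℓ (plane₂Gens κ (coneGA m h) (coneGC m gC))
          (plane₂Cofs κ (coneGA m gA) (coneQ m Q) (coneP m d P))) a).Finite ∧
      (excessSet (ciCycleFunctional ℓ (plane₁Gens κ (coneGA m gA) (coneGC m gC))
          (plane₁Cofs κ (coneGA m h) (coneQ m Q) (coneP m d P)))
        (ciCycleFunctional ℓ (plane₂Gens κ (coneGA m h) (coneGC m gC))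
          (plane₂Cofs κ (coneGA m gA) (coneQ m Q) (coneP m d P))) a).ncard =
      (excessSet (ciCycleFunctional ℓ₀ (plane₁Gens κ₀ gA gC) (plane₁Cofs κ₀ h Q P))
        (ciCycleFunctional ℓ₀ (plane₂Gens κ₀ h gC) (plane₂Cofs κ₀ gA Q P)) a).ncard := by
  obtain ⟨hfin', hle⟩ := ncard_excessSet_cone_le (κ₀ := κ₀) (κ := κ) hd hgA hh hgC hQ hP hN₀ hXN₀ hℓ₀ hJ₀ hℓ hJ
    ha hfin
  obtain ⟨-, hge⟩ := ncard_excessSet_cone_ge (κ₀ := κ₀) (κ := κ) hd hgA hh hgC hQ hP hN₀ hXN₀ hℓ₀ hJ₀ hℓ hJ a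
    hfin'
  exact ⟨hfin', le_antisymm hle hge⟩

end ConeExact

end Literature.AlgebraicGeometry.Kloosterman2025
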